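/-
Copyright (c) 2026. All rights reserved.
Released under Apache 2.0 license as described in the file LICENSE.
Authors: HodgeCM publication cell (pub-hodgecm), GR lane, seat own-crow (`pub-hodgecm-own-crow`), on GR-1's `Prop311AsPrintedHolds`.
-/
import Literature.NumberTheory.GelbartRogawski1991.Prop311AsPrintedHolds
import Literature.NumberTheory.GelbartRogawski1991.Prop311AsPrintedSymmetricOfDiagonal
import HarnessLib

/-!
# [GelbartRogawski1991, Prop. 3.1.1] — the three RECORD SHAPES of the general doubling construction HOLD (zero binders)

Topic `NumberTheory/GelbartRogawski1991`; namespaces `Literature.NumberTheory.GelbartRogawski1991.Prop311` and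
`….UnitaryDualPair` (sequel of `Prop311AsPrintedOfRecord`, `Prop311AsPrintedOfArchHalf`, `Prop311AsPrintedSymmetricOfDiagonal`,
`Prop311AsPrintedHolds`).  Theorems only; no definition, no named fact, no `sorry`, no instance attribute.

`Prop311AsPrintedOfRecord` stated the END of the general-`(F, E, σ)` doubling construction of the compatible splitting of
[GelbartRogawski1991, Prop. 3.1.1] in three record shapes, each implying the statement-exact typing `Prop311AsPrinted`:
`Prop311.SymmetricCompatibleSplitting` (all symmetric invertible Gram pairs `T_V ∈ GL_N(F)`, `T_W ∈ GL_M(F)`) ⟹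
`Prop311.DiagonalCompatibleSplitting` (diagonal data; the shape of the stage-1 record `GRConstruction.gru_shape`) ⟹
`Prop311.PairLineCompatibleSplitting` (the dual-pair LINE data `T = diag(-2 d fᵢ)`, `T_W = 1`).  `Prop311AsPrintedHolds` put the
archimedean half at diagonal data into the tree (`GRConstructionGen.exists_isArchHalf_diagonal`) and proved `Prop311AsPrinted`.
THIS FILE records that the same input inhabits all three record shapes, i.e. that the END statement of the general doubling
construction is now a tree theorem in each of its typings:

* **`Prop311.diagonalCompatibleSplitting_holds : DiagonalCompatibleSplitting`** (`diagonalCompatibleSplitting_of_diagonalArchHalf`);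
* **`Prop311.symmetricCompatibleSplitting_holds : SymmetricCompatibleSplitting`** — the general `gru_shape`: for EVERY quadratic
  extension of number fields `E/F` and EVERY symmetric `F`-rational Gram pair, the metaplectic cover `Mp(𝕎^𝔻)ᶜᵒⁿᵗ → Sp(𝔸_F)`
  splits continuously over `U(T_V ⊗ T_W)(𝔸_F)`, compatibly with Weil's rational section
  (`GRConstructionGen.symmetricCompatibleSplitting_of_diagonalArchHalf`: orthogonal bases + congruence invariance of the record);
* **`Prop311.pairLineCompatibleSplitting_holds : PairLineCompatibleSplitting`**;
* the pointwise consumer forms **`UnitaryDualPair.compatibleSplitting_splittingDatum`** (the record at ANY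
  `UnitaryDualPair.splittingDatum F E c N M e JV JW …`, whatever its proof arguments) and
  `Prop311.compatibleSplitting_pairLineDatum` (every dual-pair LINE datum; supersedes the `IsTotallyComplex E` version of
  `Prop311AsPrintedTotallyComplex`).

Nothing here is a claim of the manuscripts adjudicated by the Hodge-CM cell; HC_CM is not touched.

## References
* [GelbartRogawski1991] S. Gelbart, J. Rogawski, Invent. Math. 105 (1991) 445–472, §3.1 Proposition 3.1.1 p. 455 L1–3, §3.2 p. 457.
* [Kudla1994] S. Kudla, Israel J. Math. 87 (1994), §3 Thm. 3.1.
-/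

set_option autoImplicit false

noncomputable section

open scoped Matrix
open NumberField
open Literature.NumberTheory.Automorphic

namespace Literature.NumberTheory.GelbartRogawski1991

open Literature.NumberTheory.GaloisRepresentations Literature.RepresentationTheory.HarrisKudlaSweet1996

namespace Prop311

open UnitaryDualPair

/-- **The record for DIAGONAL dual-pair data HOLDS** — [GelbartRogawski1991, Prop. 3.1.1] in the record form
`SplittingDatum.CompatibleSplitting` for `U(diag dV ⊗ diag dW)(𝔸_F)`, every quadratic `E/F` (`c δ = -δ ≠ 0`, `δ² = d`), every
re-indexing `e` and all non-zero diagonal data: the archimedean half at diagonal data (`GRConstructionGen.exists_isArchHalf_diagonal`,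
`Prop311AsPrintedHolds`) fed into `GRConstructionGen.diagonalCompatibleSplitting_of_diagonalArchHalf`.
[cite: GelbartRogawski1991, §3.1 Proposition 3.1.1, p. 455 L1–3; §3.2 p. 457] [cite: Kudla1994, §3 Thm. 3.1] -/
theorem diagonalCompatibleSplitting_holds : DiagonalCompatibleSplitting := by
  refine GRConstructionGen.diagonalCompatibleSplitting_of_diagonalArchHalf ?_
  intro F _ _ E _ _ _ _ c δ hcδ hδ d hd N M n e dV hdV0 dW hdW0 χ hχu hχ
  exact GRConstructionGen.exists_isArchHalf_diagonal F E c hcδ hδ hd e dV (Matrix.isSymm_diagonal dV)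
    (isUnit_det_diagonal_of_ne_zero dV hdV0) hdV0 dW (Matrix.isSymm_diagonal dW) (isUnit_det_diagonal_of_ne_zero dW hdW0)
    hdW0 hχu hχ

/-- **The record for SYMMETRIC dual-pair data HOLDS (the general `gru_shape`)** — [GelbartRogawski1991, Prop. 3.1.1] in the record
form `SplittingDatum.CompatibleSplitting` for `U(T_V ⊗ T_W)(𝔸_F)`, EVERY quadratic extension of number fields `E/F`
(`c δ = -δ ≠ 0`, `δ² = d`), every re-indexing `e : Fin N × Fin M ≃ Fin n` and ALL symmetric invertible `T_V ∈ GL_N(F)`,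
`T_W ∈ GL_M(F)`: the diagonal record transported along an `F`-rational congruence to an orthogonal basis
(`symmetricCompatibleSplitting_of_diagonalCompatibleSplitting`).
[cite: GelbartRogawski1991, §3.1 Proposition 3.1.1, p. 455 L1–3; §3.2 p. 457] [cite: Kudla1994, §3 Thm. 3.1] -/
theorem symmetricCompatibleSplitting_holds : SymmetricCompatibleSplitting :=
  symmetricCompatibleSplitting_of_diagonalCompatibleSplitting diagonalCompatibleSplitting_holds

/-- **The record for the dual-pair LINE data HOLDS** — [GelbartRogawski1991, Prop. 3.1.1] in the record form
`SplittingDatum.CompatibleSplitting` for `U(T ⊗ 1)(𝔸_F)`, `T = diag(-2 d fᵢ)` invertible, every quadratic `E/F`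
(`pairLineCompatibleSplitting_of_diagonalCompatibleSplitting`, the J9 route).
[cite: GelbartRogawski1991, §3.1 Proposition 3.1.1, p. 455 L1–2; §3.2 p. 457] -/
theorem pairLineCompatibleSplitting_holds : PairLineCompatibleSplitting :=
  pairLineCompatibleSplitting_of_diagonalCompatibleSplitting diagonalCompatibleSplitting_holds

end Prop311

/-! ## Pointwise consumer forms -/

namespace UnitaryDualPair

/-- **[GelbartRogawski1991, Prop. 3.1.1] at EVERY general dual-pair datum of the tree**: for every quadratic extension of number
fields `E/F` with `c δ = -δ ≠ 0`, `δ² = d`, every re-indexing `e` and every symmetric invertible `F`-rational Gram pair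
`(T_V, T_W)` with hermitian matrices `J_V = T_V ⊗_F E`, `J_W = T_W ⊗_F E` (ANY proof arguments), the splitting datum
`UnitaryDualPair.splittingDatum F E c N M e JV JW …` has the compatible splitting: a continuous homomorphic section of
`Mp(𝕎^𝔻)ᶜᵒⁿᵗ → Sp(𝔸_F)` over `U(J_V ⊗ J_W)(𝔸_F)` mapping rational points into Weil's `r_F(Sp_F)`.
(`Prop311.symmetricCompatibleSplitting_holds`; proof arguments are irrelevant, `compatibleSplitting_splittingDatum_congr`.)
[cite: GelbartRogawski1991, §3.1 Proposition 3.1.1, p. 455 L1–3; §3.2 p. 457] -/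
theorem compatibleSplitting_splittingDatum (F E : Type) [Field F] [NumberField F] [Field E] [NumberField E] [Algebra F E]
    [Algebra.IsQuadraticExtension F E] (c : E ≃ₐ[F] E) (N M : ℕ) {n : ℕ} (e : Fin N × Fin M ≃ Fin n)
    {δ : E} (hcδ : c δ = -δ) (hδ : δ ≠ 0) {d : F} (hd : δ * δ = algebraMap F E d)
    {JV : Matrix (Fin N) (Fin N) E} {JW : Matrix (Fin M) (Fin M) E}
    {TV : Matrix (Fin N) (Fin N) F} {TW : Matrix (Fin M) (Fin M) F}
    (hV : TV.IsSymm) (hW : TW.IsSymm) (hVd : IsUnit TV.det) (hWd : IsUnit TW.det)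
    (hJV : JV = TV.map (algebraMap F E)) (hJW : JW = TW.map (algebraMap F E)) :
    (splittingDatum F E c N M e JV JW hcδ hδ hd hV hW hVd hWd hJV hJW).CompatibleSplitting :=
  (compatibleSplitting_splittingDatum_congr F E c N M e hcδ hδ hd hV hW hVd hWd rfl rfl hV hW hVd hWd hJV hJW
    rfl rfl hJV hJW).1 (Prop311.symmetricCompatibleSplitting_holds F E c δ hcδ hδ d hd N M n e TV hV hVd TW hW hWd)

end UnitaryDualPair

namespace Prop311

open UnitaryDualPair

/-- **[GelbartRogawski1991, Prop. 3.1.1] at every dual-pair LINE datum of the tree** (`pairLineDatum F E σ hσδ hδ hd f e hT`: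
`U(T ⊗ 1)(𝔸_F)`, `T = diag(-2 d fᵢ)` invertible, EVERY quadratic `E/F`): the compatible splitting exists — J9 at the ambient
`(F, E, σ)` (`N = n`, `M = 1`, `dVᵢ = -2 d fᵢ ≠ 0`, `dW = 1`, `compatibleSplitting_splittingDatum_congr`) applied to
`diagonalCompatibleSplitting_holds`; supersedes `compatibleSplitting_pairLineDatum_of_isTotallyComplex` (no `IsTotallyComplex E`).
[cite: GelbartRogawski1991, §3.1 Proposition 3.1.1, p. 455 L1–2; §3.2 p. 457] -/
theorem compatibleSplitting_pairLineDatum (F : Type) [Field F] [NumberField F] (E : Type) [Field E] [NumberField E]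
    [Algebra F E] [Algebra.IsQuadraticExtension F E] (σ : E ≃ₐ[F] E) {δ : E} (hσδ : σ δ = -δ) (hδ : δ ≠ 0) {d : F}
    (hd : δ * δ = algebraMap F E d) {n : ℕ} (f : Fin n → F) (e : Fin n × Fin 1 ≃ Fin n)
    (hT : IsUnit (symplecticGram F d f).det) :
    (pairLineDatum F E σ hσδ hδ hd f e hT).CompatibleSplitting := by
  have hf0 : ∀ i, -2 * d * f i ≠ 0 := by
    have h1 : (∏ i, (-2 * d * f i)) ≠ 0 := by
      have h2 := hT.ne_zero
      rwa [symplecticGram, Matrix.det_diagonal] at h2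
    exact fun i => (Finset.prod_ne_zero_iff.1 h1) i (Finset.mem_univ i)
  have h1 := diagonalCompatibleSplitting_holds F E σ δ hσδ hδ d hd n 1 n e (fun i => -2 * d * f i) hf0
    (fun _ => (1 : F)) (fun _ => one_ne_zero)
  exact (compatibleSplitting_splittingDatum_congr F E σ n 1 e hσδ hδ hd
    (Matrix.isSymm_diagonal fun i => -2 * d * f i) (Matrix.isSymm_diagonal fun _ : Fin 1 => (1 : F))
    (isUnit_det_diagonal_of_ne_zero (fun i => -2 * d * f i) hf0)
    (isUnit_det_diagonal_of_ne_zero (fun _ : Fin 1 => (1 : F)) fun _ => one_ne_zero) rfl rfl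
    (isSymm_symplecticGram F d f) Matrix.isSymm_one hT (by rw [Matrix.det_one]; exact isUnit_one) rfl (one_eq_map_one F E)
    rfl Matrix.diagonal_one.symm rfl (by rw [Matrix.diagonal_one]; exact one_eq_map_one F E)).1 h1

end Prop311


end Literature.NumberTheory.GelbartRogawski1991

end
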